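import Mathlib
import Literature.Geometry.Lorentzian.LandauLifshitzPseudotensor

/-!
# Sketch (crux-ideate, round 1, ideator 3) — crux `InertialRecession` (stmt-FinalStateConjecture-17403)

First lemmas of two crux idea cards, stated over existing declarations (Mathlib + the tree's
`Literature.Geometry.Lorentzian.LandauLifshitz`). Statements only (`sorry`); they must ELABORATE.

* Card `convexity-freezes-the-clustering`: `twoLevelChargeConvexity` — the charge-form
  Graf–Dereziński convexity step for ONE cluster splitting into two (Mathlib-only).
* Card `constant-weight-cutoffs`: `softCharge` / `softChargeLaw` — the soft Landau–Lifshitz charge of an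
  arbitrary moving smooth cut-off and its EXACT balance identity (pure chart calculus, every smooth metric
  field; vacuum is needed only later, to bound the right-hand side), and `ballisticEncounterIntegral`
  (Mathlib-only kinematics of a ballistic passage).
-/

open scoped BigOperators Topology
open Filter Set MeasureTheory Literature.Geometry.Lorentzian

noncomputable section

namespace Summit.FinalStateConjecture.FinalStateConjecture.Cruxes.InertialRecession.SketchIdeator3

/-! ## Card `convexity-freezes-the-clustering` -/

/-- **Two-level charge convexity (the inductive step of the charge-form Graf–Dereziński argument).**
A "cluster" `C` carries a charge triple (energy `ℰC`, momentum `𝒫C`, mass dipole `𝒟C`) obeying the three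
soft window laws with rates `r` (energy, momentum) and `rD` (dipole: `‖𝒟̇ − 𝒫‖ ≤ rD`) at ALL late times
(its cut-off is always clean); two candidate sub-clusters carry triples `(ℰᵢ, 𝒫ᵢ, 𝒟ᵢ)` obeying the laws only
while their energy centres are `θ t` apart (only then are their cut-offs clean; NO additivity
`ℰC = ℰ₁ + ℰ₂` is assumed — it is not needed for quasi-monotonicity). Energies positive and bounded, momenta
bounded, dipoles `O(t)`; `r` and `rD / t` integrable. Then for every `C²` convex non-decreasing `f` vanishing
on `(-∞, θ²]` the interpolated Graf functional
`Φ(t) = ℰC |YC|²/2 + (μ/2) f(|Y₁ − Y₂|²)`, `YC = 𝒟C/(t ℰC)`, `Yᵢ = 𝒟ᵢ/(t ℰᵢ)`, `μ = ℰ₁ℰ₂/(ℰ₁+ℰ₂)`,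
CONVERGES as `t → ∞` (quasi-monotonicity: `Φ' = G/t + σ`, `∫|σ| < ∞`,
`(tG)' ≥ ℰC |𝒫C/ℰC − YC|² + μ f' |U − W|² + 2 μ f'' (W·(U−W))² − C (t r + rD)`). [folklore] -/
theorem twoLevelChargeConvexity
    (ℰC ℰ₁ ℰ₂ eC e₁ e₂ r rD : ℝ → ℝ) (𝒫C 𝒫₁ 𝒫₂ 𝒟C 𝒟₁ 𝒟₂ pC p₁ p₂ dC d₁ d₂ : ℝ → E3) (f : ℝ → ℝ)
    (t₀ m K θ : ℝ) (ht₀ : 0 < t₀) (hm : 0 < m) (hθ : 0 < θ)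
    (hf : ContDiff ℝ 2 f) (hfm : Monotone f) (hfc : ConvexOn ℝ univ f) (hf0 : ∀ x ≤ θ ^ 2, f x = 0)
    (hderiv : ∀ t, t₀ ≤ t → HasDerivAt ℰC (eC t) t ∧ HasDerivAt 𝒫C (pC t) t ∧ HasDerivAt 𝒟C (dC t) t ∧
      HasDerivAt ℰ₁ (e₁ t) t ∧ HasDerivAt ℰ₂ (e₂ t) t ∧ HasDerivAt 𝒫₁ (p₁ t) t ∧
      HasDerivAt 𝒫₂ (p₂ t) t ∧ HasDerivAt 𝒟₁ (d₁ t) t ∧ HasDerivAt 𝒟₂ (d₂ t) t)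
    (hbd : ∀ t, t₀ ≤ t → m ≤ ℰC t ∧ m ≤ ℰ₁ t ∧ m ≤ ℰ₂ t ∧ ℰC t ≤ K ∧ ℰ₁ t ≤ K ∧ ℰ₂ t ≤ K ∧
      ‖𝒫C t‖ ≤ K ∧ ‖𝒫₁ t‖ ≤ K ∧ ‖𝒫₂ t‖ ≤ K ∧ ‖𝒟C t‖ ≤ K * t ∧ ‖𝒟₁ t‖ ≤ K * t ∧ ‖𝒟₂ t‖ ≤ K * t)
    (hr : ∀ t, t₀ ≤ t → 0 ≤ r t ∧ 0 ≤ rD t)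
    (hcoarse : ∀ t, t₀ ≤ t → |eC t| ≤ r t ∧ ‖pC t‖ ≤ r t ∧ ‖dC t - 𝒫C t‖ ≤ rD t)
    (hsplit : ∀ t, t₀ ≤ t → θ * t ≤ ‖(ℰ₁ t)⁻¹ • 𝒟₁ t - (ℰ₂ t)⁻¹ • 𝒟₂ t‖ →
      |e₁ t| ≤ r t ∧ |e₂ t| ≤ r t ∧ ‖p₁ t‖ ≤ r t ∧ ‖p₂ t‖ ≤ r t ∧
      ‖d₁ t - 𝒫₁ t‖ ≤ rD t ∧ ‖d₂ t - 𝒫₂ t‖ ≤ rD t)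
    (hint : IntegrableOn r (Ioi t₀)) (hintD : IntegrableOn (fun t ↦ rD t / t) (Ioi t₀)) :
    ∃ L : ℝ, Tendsto (fun t ↦ ℰC t / 2 * ‖(t * ℰC t)⁻¹ • 𝒟C t‖ ^ 2 +
      ℰ₁ t * ℰ₂ t / (ℰ₁ t + ℰ₂ t) / 2 *
        f (‖t⁻¹ • ((ℰ₁ t)⁻¹ • 𝒟₁ t - (ℰ₂ t)⁻¹ • 𝒟₂ t)‖ ^ 2)) atTop (𝓝 L) := by
  sorry

/-! ## Card `constant-weight-cutoffs` -/

/-- The **soft Landau–Lifshitz charge** of a (time-dependent) smooth cut-off `φ t : E3 → ℝ` in the lab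
slice `{x⁰ = t}`: `𝒫^μ[φ](t) = −∫ Σ_k ∂_k φ(t, y) · h^{μ0k}(t, y) d³y`. For a radial profile it is the
radius-average of `LandauLifshitz.quasiLocalMomentum` (co-area); in general it only sees the metric on
`supp ∇φ`, so black-hole cores may sit where `φ` is locally constant. [folklore] -/
def softCharge (g : E4 → E4 →L[ℝ] E4 →L[ℝ] ℝ) (φ : ℝ → E3 → ℝ) (t : ℝ) (μ : Fin 4) : ℝ :=
  -∫ y : E3, ∑ k : Fin 3, fderiv ℝ (φ t) y (EuclideanSpace.single k 1) *
      LandauLifshitz.hField g (E4.ofTimeSpace t y) μ 0 k.succ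

/-- **Soft charge law (exact balance identity for an arbitrary moving cut-off).** For EVERY smooth field
of bilinear forms `g` on an open `V ⊆ E4` and every jointly `C²` cut-off `φ` whose space- and
time-derivatives vanish off a compact `K` with `(t', K) ⊆ V` for `t'` near `t` (`g` non-degenerate on `V`, so that the
inverse components are smooth; no symmetry, no signature, no field equations):
`d/dt 𝒫^μ[φ] = ∫ (∂_t φ) τ^{μ0} + Σ_k (∂_k φ) τ^{μk}`, `τ = emComplex g = Σ_α ∂_α h^{μνα}`
(`= (−g)(G^{μν}/8π + t^{μν}_LL)`). Proof: integrate by parts in space; `h^{μ00} = 0` and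
`Σ_{jk} (∂_j∂_k φ) h^{μkj} = 0` (`hField_swap`, `hField_self`) — no field equations. Where `Ric g = 0`
on `supp ∇φ ∪ supp ∂_tφ` the right side is quadratic in `∂g` (pseudotensor bound). [folklore] -/
theorem softChargeLaw (g : E4 → E4 →L[ℝ] E4 →L[ℝ] ℝ) (V : Set E4) (φ : ℝ → E3 → ℝ)
    (K : Set E3) (t δ : ℝ) (hV : IsOpen V) (hg : ContDiffOn ℝ ((⊤ : ℕ∞) : WithTop ℕ∞) g V)
    (hdet : ∀ x ∈ V, LandauLifshitz.metricDet g x ≠ 0) (hδ : 0 < δ) (hK : IsCompact K) (hKV : ∀ t' ∈ Ioo (t - δ) (t + δ), ∀ y ∈ K, E4.ofTimeSpace t' y ∈ V)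
    (hφ : ContDiff ℝ 2 (fun p : ℝ × E3 ↦ φ p.1 p.2))
    (hoff : ∀ t' ∈ Ioo (t - δ) (t + δ), ∀ y ∉ K, fderiv ℝ (φ t') y = 0 ∧ deriv (fun s ↦ φ s y) t' = 0) :
    ∀ μ : Fin 4, HasDerivAt (fun s ↦ softCharge g φ s μ)
      (∫ y : E3, (deriv (fun s ↦ φ s y) t * LandauLifshitz.emComplex g (E4.ofTimeSpace t y) μ 0 +
        ∑ k : Fin 3, fderiv ℝ (φ t) y (EuclideanSpace.single k 1) *
          LandauLifshitz.emComplex g (E4.ofTimeSpace t y) μ k.succ)) t := by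
  sorry

/-- **Ballistic encounter integrals (Mathlib-only).** If `η − ξ` has a component along a fixed unit
vector `n` growing at rate `≥ W/2` on `[t₁, t₂]` and stays at distance `≥ D > 0`, then
`∫ ‖η − ξ‖⁻² ≤ 8/(W D)` and `∫ ‖η − ξ‖^{-3/2} ≤ 12/(W √D)` on `[t₁, t₂]`, uniformly in `t₂ − t₁`
(substitute `u = ⟪η − ξ, n⟫`, `‖η − ξ‖ ≥ max(D, |u|)`). [folklore] -/
theorem ballisticEncounterIntegral (ξ η : ℝ → E3) (n : E3) (W D t₁ t₂ : ℝ) (hW : 0 < W) (hD : 0 < D)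
    (ht : t₁ ≤ t₂) (hn : ‖n‖ = 1) (hξ : Differentiable ℝ ξ) (hη : Differentiable ℝ η)
    (hcont : Continuous (deriv ξ) ∧ Continuous (deriv η))
    (hball : ∀ s ∈ Icc t₁ t₂, W / 2 ≤ inner ℝ (deriv η s - deriv ξ s) n)
    (hfar : ∀ s ∈ Icc t₁ t₂, D ≤ ‖η s - ξ s‖) :
    ∫ s in t₁..t₂, (‖η s - ξ s‖ ^ 2)⁻¹ ≤ 8 / (W * D) ∧
      ∫ s in t₁..t₂, (‖η s - ξ s‖ ^ (3 / 2 : ℝ))⁻¹ ≤ 12 / (W * Real.sqrt D) := by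
  sorry

end Summit.FinalStateConjecture.FinalStateConjecture.Cruxes.InertialRecession.SketchIdeator3

end
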